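/-
Copyright (c) 2026 the pub-hodgecm-mathlib formalisation cell (harness21).  Prover seat hodgecm-mathlib-K2Liu-p09 (g5): Track B «K2-LIT»,
hLiu418 = stmt-HodgeConjecture-24832; LEAD F0P6-plan RULINGS M-156m∕o, M-157a (4)∕c «A7 = GK COCYCLE ROAD», file B7-A.
-/
import Summits.HodgeConjecture.HodgeConjecture.Theorems.K2LiuSiegelCocycleLetters              -- ★ B4d-1b (+ B4d-1, B1b-2c, B1b-2a, B4c-*)
import Literature.NumberTheory.Automorphic.AdelicVectorHeightGalois                            -- ★ `norm_galAdicCompletionMap`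
import Literature.NumberTheory.Automorphic.TateLocalZetaShells                                 -- ★ `integral_comp_mul_left` (`dμ(a y) = |a|⁻¹ dμ(y)`)
import HarnessLib

/-!
# Crux `HLiu418`, road `K2_Liu`, organ A7-reg (GK cocycle road), file B7-A:
# THE LONG-ROOT RANK-ONE OPERATOR `(𝒜F)(g) = ∫_{F_v} F(φ(w₂) φ(u_{2e₂}(ι_v(y)δ)) g) dy` — invariances, torus law, letters

Cell `hodgecm-mathlib`, crux item hLiu418 = `stmt-HodgeConjecture-24832`; squad K2 ∕ K2Liu; prover K2Liu-p09 (g5).  THEOREMS ONLY (no `def`, no instance,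
no notation, no named-fact hypothesis, no `sorry`); lane `--supports stmt-HodgeConjecture-24832` (count-neutral helper).  ONE FRAME (RULING M-156o (c)):
`φ := frameConj Q ∘ toLocalFour` (★ B1b-1, K2Liu-p03 (g6)).
THE POINT.  The first and the last step of the cocycle `M_v(s) = A₂ A₁ A₂` are the rank-one operator `𝒜` above, applied to a function `F : H_v → ℂ` with
(N) invariance under the transported unipotent letters and (T) a torus law `F(φ(t(a,b)) g) = θ a b · F g` (★ B4d-1b: Siegel sections; this file and B7-B: the
partial operators).  Here, for an additive Haar measure `μ_F` on `F_v`: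
* §0 `E ⊗ F_v`-bookkeeping: `σ`-fixed elements are `ι_v(β)`; `(σ x)_{w′} = c_w(x_w)` for `c • w = w′`; `∏_w ‖(σ x)_w‖ = ∏_w ‖x_w‖` (★ `norm_galAdicCompletionMap`);
  `ι_v β = b σ(b) ⟹ |β|_v = ∏_w ‖b_w‖` (★ `prod_norm_toPlace_eq_sq`).
* §1 (N) is inherited: `𝒜F(φ(ℓ) g) = 𝒜F(g)` for `ℓ = u₋(r)` (needs (N) for `u₊, u_{2e₁}, u₋`), `u₊(z)` (needs `u₋`), `u_{2e₁}(y)`, and `u_{2e₂}(b)` (Haar translation),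
  hence for every block letter `n(X)` (★ B4d-1 words, integrated).
* §2 (T) transforms: **`𝒜F(φ(t(a,b)) g) = θ a (σb)⁻¹ · (∏_w ‖b_w‖) · 𝒜F(g)`** (★ B4d-1 torus word + the substitution `y ↦ β y`, `ι_v β = bσ(b)`,
  `dμ_F(β y) = |β|_v dμ_F(y)`, ★ `integral_comp_mul_left`).
* (sequel `K2LiuSiegelCocycleStageLetters`: the letters `u`, `ū` of ★ `K2LiuRankOneOperators.exists_level₂` — `u(0) = 1`, continuity through K2Liu-p03 (g6)'s
  coordinates homeomorphism of ★ B1b-2b.)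
HONEST LABEL.  `HC_CM` is proved only modulo the 7 printed citations (2 remaining named inputs: hLiu418 = `stmt-HodgeConjecture-24832`,
h413 = `stmt-HodgeConjecture-24833`) until rung 0 closes.

## References
* [Casselman1980] W. Casselman, *The unramified principal series of p-adic groups I*, Compositio Math. 40 (1980), §3 (rank-one operators, Thm. 3.1).
* [HarrisKudlaSweet1996] M. Harris, S. Kudla, W. J. Sweet, J. AMS 9 (1996), §1 (1.11)–(1.15).
* [Tate1950] J. Tate, *Fourier analysis in number fields and Hecke's zeta-functions* (1950), §2.2 (`dμ(αξ) = |α| dμ(ξ)`).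
* [CasselsFrohlichANT1967] J. W. S. Cassels, A. Fröhlich (eds.), *Algebraic Number Theory* (1967), Ch. II §10–§11, Ch. VII §1.1.
-/

set_option autoImplicit false
set_option linter.dupNamespace false -- the mandated namespace repeats `HodgeConjecture.HodgeConjecture`

noncomputable section

open NumberField IsDedekindDomain Matrix MeasureTheory
open scoped NNReal
open Literature.NumberTheory.GaloisRepresentations.IsNonarchimedeanLocalField
open Literature.NumberTheory.Automorphic Literature.NumberTheory.Automorphic.UnitaryGroup
open Literature.NumberTheory.GelbartRogawski1991.AdaptedBlocks
open Literature.NumberTheory.GelbartRogawski1991.UnitaryDualPair.LocalSplitting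
open Literature.NumberTheory.K2Lit.LocalSiegelDoubled
open Summit.HodgeConjecture.HodgeConjecture.Cruxes.HLiu418.K2LiuLocalSiegelIwasawaFrame
open Summit.HodgeConjecture.HodgeConjecture.Cruxes.HLiu418.K2LiuLocalSiegelIwasawa
open Summit.HodgeConjecture.HodgeConjecture.Cruxes.HLiu418.K2LiuLocalLFactorDefs
open Summit.HodgeConjecture.HodgeConjecture.Cruxes.HLiu418.K2LiuGKRankOneIdentityLFactor
open Summit.HodgeConjecture.HodgeConjecture.Cruxes.HLiu418.K2LiuDoubledUTwoTwoBorelFrame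
open Summit.HodgeConjecture.HodgeConjecture.Cruxes.HLiu418.K2LiuDoubledUTwoTwoWeylCocycle
open Summit.HodgeConjecture.HodgeConjecture.Cruxes.HLiu418.K2LiuDoubledUTwoTwoLevi
open Summit.HodgeConjecture.HodgeConjecture.Cruxes.HLiu418.K2LiuDoubledUTwoTwoFrameTransport
open Summit.HodgeConjecture.HodgeConjecture.Cruxes.HLiu418.K2LiuDoubledUTwoTwoRankOneRelations
open Summit.HodgeConjecture.HodgeConjecture.Cruxes.HLiu418.K2LiuDoubledUTwoTwoStepRelations
open Summit.HodgeConjecture.HodgeConjecture.Cruxes.HLiu418.K2LiuUnipDeltaRankOneCoordinates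
open Summit.HodgeConjecture.HodgeConjecture.Cruxes.HLiu418.K2LiuSiegelCocycleStepLong
open Summit.HodgeConjecture.HodgeConjecture.Cruxes.HLiu418.K2LiuSiegelCocycleLetters

namespace Summit.HodgeConjecture.HodgeConjecture.Cruxes.HLiu418.K2LiuSiegelCocycleStageLong

variable (F : Type) [Field F] [NumberField F] (E : Type) [Field E] [NumberField E] [Algebra F E]
  [Algebra.IsQuadraticExtension F E] (c : E ≃ₐ[F] E)
  {δ : E} (hcδ : c δ = -δ) (hδ : δ ≠ 0) {d : F} (hd : δ * δ = algebraMap F E d) (v : HeightOneSpectrum (𝓞 F))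
  {T₂ : Matrix (Fin 2) (Fin 2) F} {J₂D : Matrix (Fin (2 + 2)) (Fin (2 + 2)) E} (hJ₂D : J₂D = (gramD F 2 T₂).map (algebraMap F E))
  (Q : GL (Fin (2 + 2)) F)
  (hQ : (Q : Matrix (Fin (2 + 2)) (Fin (2 + 2)) F)ᵀ * gramD F 2 T₂ * (Q : Matrix (Fin (2 + 2)) (Fin (2 + 2)) F) = (StdForm.antidiagonal (2 + 2)).over F)

/-! ## §0 `E ⊗ F_v`: fixed elements, components of `σ`, the modulus `∏_w ‖·‖_w` -/

section LocalRing

include hcδ hδ in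
/-- **`σ r = r ⟹ r = ι_v(β)`** (apply ★ `existsUnique_coord_of_conjLocal_eq_neg` to the skew element `r δ` and cancel the unit `δ`).
[cite: CasselsFrohlichANT1967, Ch. II §10] -/
theorem exists_toLocalRing_eq_of_conjLocal_eq {r : UnitaryGroup.LocalRing E v} (hr : UnitaryGroup.conjLocal E c v r = r) :
    ∃ β : v.adicCompletion F, UnitaryGroup.toLocalRing E v β = r := by
  have hx : UnitaryGroup.conjLocal E c v (r * algebraMap E (UnitaryGroup.LocalRing E v) δ) = -(r * algebraMap E (UnitaryGroup.LocalRing E v) δ) := by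
    rw [map_mul, hr, conjLocal_algebraMap, hcδ, map_neg, mul_neg]
  obtain ⟨β, hβ, -⟩ := existsUnique_coord_of_conjLocal_eq_neg F E c hcδ hδ v hx
  exact ⟨β, ((isUnit_algebraMap_delta F E v hδ).mul_left_injective hβ).symm⟩

omit [Algebra.IsQuadraticExtension F E] in
/-- **components of `σ = c ⊗ 1`**: `(σ x)_{w′} = c_w(x_w)` whenever `c • w = w′`. [cite: CasselsFrohlichANT1967, Ch. VII §1.1] -/
theorem conjLocal_apply_of_smul_eq (x : UnitaryGroup.LocalRing E v) (w w' : PlacesOver E v) (h : c • w.1 = w'.1) :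
    UnitaryGroup.conjLocal E c v x w' = galAdicCompletionMap c h (x w) := by
  obtain ⟨w, hw⟩ := w
  have e : c⁻¹ • w'.1 = w := by rw [← h, inv_smul_smul]
  subst e
  rfl

omit [Algebra.IsQuadraticExtension F E] in
/-- **reindexing a product over the places above `v` along `w ↦ c • w`**: `∏_{w′} Φ_{w′}((σ x)_{w′}) = ∏_w Φ_{cw}(c_w(x_w))`.
[cite: CasselsFrohlichANT1967, Ch. VII §1.1] -/
theorem prod_comp_conjLocal {M : Type*} [CommMonoid M] (Φ : ∀ w : PlacesOver E v, w.1.adicCompletion E → M) (x : UnitaryGroup.LocalRing E v) :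
    ∏ w' : PlacesOver E v, Φ w' (UnitaryGroup.conjLocal E c v x w') =
      ∏ w : PlacesOver E v, Φ (galPlace c w) (galAdicCompletionMap c (rfl : c • w.1 = (galPlace c w).1) (x w)) := by
  refine (Fintype.prod_equiv ⟨galPlace c, galPlace c⁻¹, fun w => Subtype.ext (inv_smul_smul c w.1), fun w => Subtype.ext (smul_inv_smul c w.1)⟩
    _ _ fun w => ?_).symm
  exact (congrArg (Φ (galPlace c w)) (conjLocal_apply_of_smul_eq F E c v x w (galPlace c w) rfl)).symm

omit [Algebra.IsQuadraticExtension F E] in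
/-- **`σ` preserves the modulus**: `∏_w ‖(σ x)_w‖ = ∏_w ‖x_w‖` (★ `norm_galAdicCompletionMap`). [cite: CasselsFrohlichANT1967, Ch. VII §1.1] -/
theorem prod_norm_conjLocal (x : UnitaryGroup.LocalRing E v) :
    ∏ w : PlacesOver E v, ‖UnitaryGroup.conjLocal E c v x w‖ = ∏ w : PlacesOver E v, ‖x w‖ := by
  rw [prod_comp_conjLocal F E c v (fun _ y => ‖y‖)]
  exact Finset.prod_congr rfl fun w _ => norm_galAdicCompletionMap c rfl (x w)

/-- **`ι_v β = b σ(b) ⟹ |β|_v = ∏_w ‖b_w‖`** (`|β|_v² = ∏_w ‖ι_w β‖ = ∏_w ‖b_w‖ · ∏_w ‖(σb)_w‖`, ★ `prod_norm_toPlace_eq_sq`, §0).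
[cite: CasselsFrohlichANT1967, Ch. II §11] -/
theorem norm_eq_prod_norm_of_toLocalRing_eq (β : v.adicCompletion F) (b : (UnitaryGroup.LocalRing E v)ˣ)
    (h : UnitaryGroup.toLocalRing E v β =
      ((b * Units.map (UnitaryGroup.conjLocal E c v : UnitaryGroup.LocalRing E v →* UnitaryGroup.LocalRing E v) b : (UnitaryGroup.LocalRing E v)ˣ) : _)) :
    ‖β‖ = ∏ w : PlacesOver E v, ‖(b : UnitaryGroup.LocalRing E v) w‖ := by
  have hsq : ‖β‖ ^ 2 = (∏ w : PlacesOver E v, ‖(b : UnitaryGroup.LocalRing E v) w‖) *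
      ∏ w : PlacesOver E v, ‖UnitaryGroup.conjLocal E c v (b : UnitaryGroup.LocalRing E v) w‖ := by
    rw [← prod_norm_toPlace_eq_sq F E v β, ← Finset.prod_mul_distrib]
    refine Finset.prod_congr rfl fun w _ => ?_
    rw [← norm_mul, ← toLocalRing_apply E v β w, h]
    rfl
  rw [prod_norm_conjLocal F E c v, ← sq] at hsq
  exact (pow_left_inj₀ (norm_nonneg _) (Finset.prod_nonneg fun w _ => norm_nonneg _) two_ne_zero).1 hsq

end LocalRing

/-! ## §1 (N) is inherited by `𝒜F` -/

section Invariance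

variable [MeasurableSpace (v.adicCompletion F)] [BorelSpace (v.adicCompletion F)] (μF : Measure (v.adicCompletion F))
  (F' : UnitaryGroup.localPi E c (2 + 2) J₂D v → ℂ)

omit [BorelSpace (v.adicCompletion F)] in
include hcδ hδ in
/-- **`𝒜F(φ(u₋(r)) g) = 𝒜F(g)`** for `F` invariant under `φ(u₊)`, `φ(u_{2e₁})`, `φ(u₋)` (★ B4d-1 `apply_weylTwo_uLongTwo_mul_uMinus`, integrated).
[cite: Casselman1980, §3] -/
theorem stageLong_apply_uMinus
    (hP : ∀ (z : UnitaryGroup.LocalRing E v) (g : UnitaryGroup.localPi E c (2 + 2) J₂D v),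
      F' (FrameTransport.frameConj F E c v (2 + 2) hJ₂D (antidiagonal_over_eq_map F E 2) Q hQ
        (toLocalFour F E c v (uPlus (UnitaryGroup.LocalRing E v) (UnitaryGroup.conjLocal E c v) (UnitaryGroup.conjLocal_conjLocal c v hcδ hδ) z)) * g) = F' g)
    (hL : ∀ (y : UnitaryGroup.LocalRing E v) (hy : UnitaryGroup.conjLocal E c v y = -y) (g : UnitaryGroup.localPi E c (2 + 2) J₂D v),
      F' (FrameTransport.frameConj F E c v (2 + 2) hJ₂D (antidiagonal_over_eq_map F E 2) Q hQ
        (toLocalFour F E c v (uLongOne (UnitaryGroup.LocalRing E v) (UnitaryGroup.conjLocal E c v) y hy)) * g) = F' g)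
    (hM : ∀ (z : UnitaryGroup.LocalRing E v) (g : UnitaryGroup.localPi E c (2 + 2) J₂D v),
      F' (FrameTransport.frameConj F E c v (2 + 2) hJ₂D (antidiagonal_over_eq_map F E 2) Q hQ
        (toLocalFour F E c v (uMinus (UnitaryGroup.LocalRing E v) (UnitaryGroup.conjLocal E c v) (UnitaryGroup.conjLocal_conjLocal c v hcδ hδ) z)) * g) = F' g)
    (r : UnitaryGroup.LocalRing E v) (g : UnitaryGroup.localPi E c (2 + 2) J₂D v) :
    ∫ y, F' (FrameTransport.frameConj F E c v (2 + 2) hJ₂D (antidiagonal_over_eq_map F E 2) Q hQ (toLocalFour F E c v (weylTwo (UnitaryGroup.LocalRing E v) (UnitaryGroup.conjLocal E c v))) *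
        FrameTransport.frameConj F E c v (2 + 2) hJ₂D (antidiagonal_over_eq_map F E 2) Q hQ (toLocalFour F E c v (uLongTwo (UnitaryGroup.LocalRing E v) (UnitaryGroup.conjLocal E c v)
          (UnitaryGroup.toLocalRing E v y * algebraMap E (UnitaryGroup.LocalRing E v) δ) (conjLocal_coord F E c hcδ v y))) *
        (FrameTransport.frameConj F E c v (2 + 2) hJ₂D (antidiagonal_over_eq_map F E 2) Q hQ
          (toLocalFour F E c v (uMinus (UnitaryGroup.LocalRing E v) (UnitaryGroup.conjLocal E c v) (UnitaryGroup.conjLocal_conjLocal c v hcδ hδ) r)) * g)) ∂μF =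
      ∫ y, F' (FrameTransport.frameConj F E c v (2 + 2) hJ₂D (antidiagonal_over_eq_map F E 2) Q hQ (toLocalFour F E c v (weylTwo (UnitaryGroup.LocalRing E v) (UnitaryGroup.conjLocal E c v))) *
        FrameTransport.frameConj F E c v (2 + 2) hJ₂D (antidiagonal_over_eq_map F E 2) Q hQ (toLocalFour F E c v (uLongTwo (UnitaryGroup.LocalRing E v) (UnitaryGroup.conjLocal E c v)
          (UnitaryGroup.toLocalRing E v y * algebraMap E (UnitaryGroup.LocalRing E v) δ) (conjLocal_coord F E c hcδ v y))) * g) ∂μF :=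
  integral_congr_ae (Filter.Eventually.of_forall fun _ => apply_weylTwo_uLongTwo_mul_uMinus F E c hcδ hδ v hJ₂D Q hQ F' hP hL hM _ r _ g)

omit [BorelSpace (v.adicCompletion F)] in
include hcδ hδ in
/-- **`𝒜F(φ(u₊(z)) g) = 𝒜F(g)`** for `F` invariant under `φ(u₋)` (★ B4d-1 `apply_weylTwo_uLongTwo_mul_uPlus`). [cite: Casselman1980, §3] -/
theorem stageLong_apply_uPlus
    (hM : ∀ (z : UnitaryGroup.LocalRing E v) (g : UnitaryGroup.localPi E c (2 + 2) J₂D v),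
      F' (FrameTransport.frameConj F E c v (2 + 2) hJ₂D (antidiagonal_over_eq_map F E 2) Q hQ
        (toLocalFour F E c v (uMinus (UnitaryGroup.LocalRing E v) (UnitaryGroup.conjLocal E c v) (UnitaryGroup.conjLocal_conjLocal c v hcδ hδ) z)) * g) = F' g)
    (z : UnitaryGroup.LocalRing E v) (g : UnitaryGroup.localPi E c (2 + 2) J₂D v) :
    ∫ y, F' (FrameTransport.frameConj F E c v (2 + 2) hJ₂D (antidiagonal_over_eq_map F E 2) Q hQ (toLocalFour F E c v (weylTwo (UnitaryGroup.LocalRing E v) (UnitaryGroup.conjLocal E c v))) *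
        FrameTransport.frameConj F E c v (2 + 2) hJ₂D (antidiagonal_over_eq_map F E 2) Q hQ (toLocalFour F E c v (uLongTwo (UnitaryGroup.LocalRing E v) (UnitaryGroup.conjLocal E c v)
          (UnitaryGroup.toLocalRing E v y * algebraMap E (UnitaryGroup.LocalRing E v) δ) (conjLocal_coord F E c hcδ v y))) *
        (FrameTransport.frameConj F E c v (2 + 2) hJ₂D (antidiagonal_over_eq_map F E 2) Q hQ
          (toLocalFour F E c v (uPlus (UnitaryGroup.LocalRing E v) (UnitaryGroup.conjLocal E c v) (UnitaryGroup.conjLocal_conjLocal c v hcδ hδ) z)) * g)) ∂μF =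
      ∫ y, F' (FrameTransport.frameConj F E c v (2 + 2) hJ₂D (antidiagonal_over_eq_map F E 2) Q hQ (toLocalFour F E c v (weylTwo (UnitaryGroup.LocalRing E v) (UnitaryGroup.conjLocal E c v))) *
        FrameTransport.frameConj F E c v (2 + 2) hJ₂D (antidiagonal_over_eq_map F E 2) Q hQ (toLocalFour F E c v (uLongTwo (UnitaryGroup.LocalRing E v) (UnitaryGroup.conjLocal E c v)
          (UnitaryGroup.toLocalRing E v y * algebraMap E (UnitaryGroup.LocalRing E v) δ) (conjLocal_coord F E c hcδ v y))) * g) ∂μF :=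
  integral_congr_ae (Filter.Eventually.of_forall fun _ => apply_weylTwo_uLongTwo_mul_uPlus F E c hcδ hδ v hJ₂D Q hQ F' hM _ z _ g)

omit [Algebra.IsQuadraticExtension F E] [BorelSpace (v.adicCompletion F)] in
include hcδ in
/-- **`𝒜F(φ(u_{2e₁}(b)) g) = 𝒜F(g)`** for `F` invariant under `φ(u_{2e₁})` (★ B4d-1 `apply_weylTwo_uLongTwo_mul_uLongOne`). [cite: Casselman1980, §3] -/
theorem stageLong_apply_uLongOne
    (hL : ∀ (y : UnitaryGroup.LocalRing E v) (hy : UnitaryGroup.conjLocal E c v y = -y) (g : UnitaryGroup.localPi E c (2 + 2) J₂D v),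
      F' (FrameTransport.frameConj F E c v (2 + 2) hJ₂D (antidiagonal_over_eq_map F E 2) Q hQ
        (toLocalFour F E c v (uLongOne (UnitaryGroup.LocalRing E v) (UnitaryGroup.conjLocal E c v) y hy)) * g) = F' g)
    (b : UnitaryGroup.LocalRing E v) (hb : UnitaryGroup.conjLocal E c v b = -b) (g : UnitaryGroup.localPi E c (2 + 2) J₂D v) :
    ∫ y, F' (FrameTransport.frameConj F E c v (2 + 2) hJ₂D (antidiagonal_over_eq_map F E 2) Q hQ (toLocalFour F E c v (weylTwo (UnitaryGroup.LocalRing E v) (UnitaryGroup.conjLocal E c v))) *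
        FrameTransport.frameConj F E c v (2 + 2) hJ₂D (antidiagonal_over_eq_map F E 2) Q hQ (toLocalFour F E c v (uLongTwo (UnitaryGroup.LocalRing E v) (UnitaryGroup.conjLocal E c v)
          (UnitaryGroup.toLocalRing E v y * algebraMap E (UnitaryGroup.LocalRing E v) δ) (conjLocal_coord F E c hcδ v y))) *
        (FrameTransport.frameConj F E c v (2 + 2) hJ₂D (antidiagonal_over_eq_map F E 2) Q hQ
          (toLocalFour F E c v (uLongOne (UnitaryGroup.LocalRing E v) (UnitaryGroup.conjLocal E c v) b hb)) * g)) ∂μF =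
      ∫ y, F' (FrameTransport.frameConj F E c v (2 + 2) hJ₂D (antidiagonal_over_eq_map F E 2) Q hQ (toLocalFour F E c v (weylTwo (UnitaryGroup.LocalRing E v) (UnitaryGroup.conjLocal E c v))) *
        FrameTransport.frameConj F E c v (2 + 2) hJ₂D (antidiagonal_over_eq_map F E 2) Q hQ (toLocalFour F E c v (uLongTwo (UnitaryGroup.LocalRing E v) (UnitaryGroup.conjLocal E c v)
          (UnitaryGroup.toLocalRing E v y * algebraMap E (UnitaryGroup.LocalRing E v) δ) (conjLocal_coord F E c hcδ v y))) * g) ∂μF :=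
  integral_congr_ae (Filter.Eventually.of_forall fun _ => apply_weylTwo_uLongTwo_mul_uLongOne F E c v hJ₂D Q hQ F' hL _ b _ hb g)

include hcδ hδ in
/-- **`𝒜F(φ(u_{2e₂}(b)) g) = 𝒜F(g)`** for ANY `F` — the root variable is translated by the coordinate `β` of `b = ι_v(β)δ` and `μ_F` is translation
invariant (★ B4d-1 shift word, ★ `existsUnique_coord_of_conjLocal_eq_neg`). [cite: Casselman1980, §3] [cite: Tate1950, §2.2] -/
theorem stageLong_apply_uLongTwo [μF.IsAddRightInvariant] (b : UnitaryGroup.LocalRing E v) (hb : UnitaryGroup.conjLocal E c v b = -b)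
    (g : UnitaryGroup.localPi E c (2 + 2) J₂D v) :
    ∫ y, F' (FrameTransport.frameConj F E c v (2 + 2) hJ₂D (antidiagonal_over_eq_map F E 2) Q hQ (toLocalFour F E c v (weylTwo (UnitaryGroup.LocalRing E v) (UnitaryGroup.conjLocal E c v))) *
        FrameTransport.frameConj F E c v (2 + 2) hJ₂D (antidiagonal_over_eq_map F E 2) Q hQ (toLocalFour F E c v (uLongTwo (UnitaryGroup.LocalRing E v) (UnitaryGroup.conjLocal E c v)
          (UnitaryGroup.toLocalRing E v y * algebraMap E (UnitaryGroup.LocalRing E v) δ) (conjLocal_coord F E c hcδ v y))) *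
        (FrameTransport.frameConj F E c v (2 + 2) hJ₂D (antidiagonal_over_eq_map F E 2) Q hQ
          (toLocalFour F E c v (uLongTwo (UnitaryGroup.LocalRing E v) (UnitaryGroup.conjLocal E c v) b hb)) * g)) ∂μF =
      ∫ y, F' (FrameTransport.frameConj F E c v (2 + 2) hJ₂D (antidiagonal_over_eq_map F E 2) Q hQ (toLocalFour F E c v (weylTwo (UnitaryGroup.LocalRing E v) (UnitaryGroup.conjLocal E c v))) *
        FrameTransport.frameConj F E c v (2 + 2) hJ₂D (antidiagonal_over_eq_map F E 2) Q hQ (toLocalFour F E c v (uLongTwo (UnitaryGroup.LocalRing E v) (UnitaryGroup.conjLocal E c v)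
          (UnitaryGroup.toLocalRing E v y * algebraMap E (UnitaryGroup.LocalRing E v) δ) (conjLocal_coord F E c hcδ v y))) * g) ∂μF := by
  obtain ⟨β, rfl, -⟩ := existsUnique_coord_of_conjLocal_eq_neg F E c hcδ hδ v hb
  have h : ∀ y : v.adicCompletion F,
      F' (FrameTransport.frameConj F E c v (2 + 2) hJ₂D (antidiagonal_over_eq_map F E 2) Q hQ (toLocalFour F E c v (weylTwo (UnitaryGroup.LocalRing E v) (UnitaryGroup.conjLocal E c v))) *
        FrameTransport.frameConj F E c v (2 + 2) hJ₂D (antidiagonal_over_eq_map F E 2) Q hQ (toLocalFour F E c v (uLongTwo (UnitaryGroup.LocalRing E v) (UnitaryGroup.conjLocal E c v)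
          (UnitaryGroup.toLocalRing E v y * algebraMap E (UnitaryGroup.LocalRing E v) δ) (conjLocal_coord F E c hcδ v y))) *
        (FrameTransport.frameConj F E c v (2 + 2) hJ₂D (antidiagonal_over_eq_map F E 2) Q hQ
          (toLocalFour F E c v (uLongTwo (UnitaryGroup.LocalRing E v) (UnitaryGroup.conjLocal E c v) _ hb)) * g)) =
      F' (FrameTransport.frameConj F E c v (2 + 2) hJ₂D (antidiagonal_over_eq_map F E 2) Q hQ (toLocalFour F E c v (weylTwo (UnitaryGroup.LocalRing E v) (UnitaryGroup.conjLocal E c v))) *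
        FrameTransport.frameConj F E c v (2 + 2) hJ₂D (antidiagonal_over_eq_map F E 2) Q hQ (toLocalFour F E c v (uLongTwo (UnitaryGroup.LocalRing E v) (UnitaryGroup.conjLocal E c v)
          (UnitaryGroup.toLocalRing E v (y + β) * algebraMap E (UnitaryGroup.LocalRing E v) δ) (conjLocal_coord F E c hcδ v (y + β)))) * g) := by
    intro y
    rw [weylTwo_uLongTwo_mul_uLongTwo_apply F E c v hJ₂D Q hQ, uLongTwo_congr F E c v _ (conjLocal_coord F E c hcδ v (y + β)) (by rw [map_add, add_mul])]
  simp_rw [h]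
  exact integral_add_right_eq_self (μ := μF) (fun y => F' (FrameTransport.frameConj F E c v (2 + 2) hJ₂D (antidiagonal_over_eq_map F E 2) Q hQ (toLocalFour F E c v (weylTwo (UnitaryGroup.LocalRing E v) (UnitaryGroup.conjLocal E c v))) *
        FrameTransport.frameConj F E c v (2 + 2) hJ₂D (antidiagonal_over_eq_map F E 2) Q hQ (toLocalFour F E c v (uLongTwo (UnitaryGroup.LocalRing E v) (UnitaryGroup.conjLocal E c v)
          (UnitaryGroup.toLocalRing E v y * algebraMap E (UnitaryGroup.LocalRing E v) δ) (conjLocal_coord F E c hcδ v y))) * g)) β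

include hcδ hδ in
/-- **`𝒜F(φ(n(X)) g) = 𝒜F(g)`** for every skew block `X`, for `F` invariant under `φ(u_{2e₁})` and `φ(u₋)`: `n(X) = u_{2e₂}(x) u₊(z) u_{2e₁}(y)`
(★ `nSiegel_eq_nSiegelBlk`) and the three clauses above. [cite: HarrisKudlaSweet1996, §1 (1.11)] [cite: Casselman1980, §3] -/
theorem stageLong_apply_nSiegelBlk [μF.IsAddRightInvariant]
    (hL : ∀ (y : UnitaryGroup.LocalRing E v) (hy : UnitaryGroup.conjLocal E c v y = -y) (g : UnitaryGroup.localPi E c (2 + 2) J₂D v),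
      F' (FrameTransport.frameConj F E c v (2 + 2) hJ₂D (antidiagonal_over_eq_map F E 2) Q hQ
        (toLocalFour F E c v (uLongOne (UnitaryGroup.LocalRing E v) (UnitaryGroup.conjLocal E c v) y hy)) * g) = F' g)
    (hM : ∀ (z : UnitaryGroup.LocalRing E v) (g : UnitaryGroup.localPi E c (2 + 2) J₂D v),
      F' (FrameTransport.frameConj F E c v (2 + 2) hJ₂D (antidiagonal_over_eq_map F E 2) Q hQ
        (toLocalFour F E c v (uMinus (UnitaryGroup.LocalRing E v) (UnitaryGroup.conjLocal E c v) (UnitaryGroup.conjLocal_conjLocal c v hcδ hδ) z)) * g) = F' g)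
    (X : Matrix (Fin 2) (Fin 2) (UnitaryGroup.LocalRing E v)) (hX : IsSkewTwo (UnitaryGroup.LocalRing E v) (UnitaryGroup.conjLocal E c v) X)
    (g : UnitaryGroup.localPi E c (2 + 2) J₂D v) :
    ∫ y, F' (FrameTransport.frameConj F E c v (2 + 2) hJ₂D (antidiagonal_over_eq_map F E 2) Q hQ (toLocalFour F E c v (weylTwo (UnitaryGroup.LocalRing E v) (UnitaryGroup.conjLocal E c v))) *
        FrameTransport.frameConj F E c v (2 + 2) hJ₂D (antidiagonal_over_eq_map F E 2) Q hQ (toLocalFour F E c v (uLongTwo (UnitaryGroup.LocalRing E v) (UnitaryGroup.conjLocal E c v)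
          (UnitaryGroup.toLocalRing E v y * algebraMap E (UnitaryGroup.LocalRing E v) δ) (conjLocal_coord F E c hcδ v y))) *
        (FrameTransport.frameConj F E c v (2 + 2) hJ₂D (antidiagonal_over_eq_map F E 2) Q hQ
          (toLocalFour F E c v (nSiegelBlk (UnitaryGroup.LocalRing E v) (UnitaryGroup.conjLocal E c v) hX)) * g)) ∂μF =
      ∫ y, F' (FrameTransport.frameConj F E c v (2 + 2) hJ₂D (antidiagonal_over_eq_map F E 2) Q hQ (toLocalFour F E c v (weylTwo (UnitaryGroup.LocalRing E v) (UnitaryGroup.conjLocal E c v))) *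
        FrameTransport.frameConj F E c v (2 + 2) hJ₂D (antidiagonal_over_eq_map F E 2) Q hQ (toLocalFour F E c v (uLongTwo (UnitaryGroup.LocalRing E v) (UnitaryGroup.conjLocal E c v)
          (UnitaryGroup.toLocalRing E v y * algebraMap E (UnitaryGroup.LocalRing E v) δ) (conjLocal_coord F E c hcδ v y))) * g) ∂μF := by
  obtain ⟨e10, e00, -, e01⟩ := hX.entries
  have hx : UnitaryGroup.conjLocal E c v (X 1 0) = -X 1 0 := eq_neg_of_add_eq_zero_left e10
  have hy : UnitaryGroup.conjLocal E c v (X 0 1) = -X 0 1 := eq_neg_of_add_eq_zero_left e01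
  have h11 : X 1 1 = -UnitaryGroup.conjLocal E c v (X 0 0) := eq_neg_of_add_eq_zero_right e00
  have hXe : X = !![X 0 0, X 0 1; X 1 0, -UnitaryGroup.conjLocal E c v (X 0 0)] := by
    rw [← h11]; exact Matrix.eta_fin_two X
  have hn : FrameTransport.frameConj F E c v (2 + 2) hJ₂D (antidiagonal_over_eq_map F E 2) Q hQ
        (toLocalFour F E c v (nSiegelBlk (UnitaryGroup.LocalRing E v) (UnitaryGroup.conjLocal E c v) hX)) =
      FrameTransport.frameConj F E c v (2 + 2) hJ₂D (antidiagonal_over_eq_map F E 2) Q hQ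
          (toLocalFour F E c v (uLongTwo (UnitaryGroup.LocalRing E v) (UnitaryGroup.conjLocal E c v) (X 1 0) hx)) *
        FrameTransport.frameConj F E c v (2 + 2) hJ₂D (antidiagonal_over_eq_map F E 2) Q hQ
          (toLocalFour F E c v (uPlus (UnitaryGroup.LocalRing E v) (UnitaryGroup.conjLocal E c v) (UnitaryGroup.conjLocal_conjLocal c v hcδ hδ) (X 0 0))) *
        FrameTransport.frameConj F E c v (2 + 2) hJ₂D (antidiagonal_over_eq_map F E 2) Q hQ
          (toLocalFour F E c v (uLongOne (UnitaryGroup.LocalRing E v) (UnitaryGroup.conjLocal E c v) (X 0 1) hy)) := by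
    rw [nSiegelBlk_congr (UnitaryGroup.LocalRing E v) (UnitaryGroup.conjLocal E c v) hX
      (isSkewTwo_coords (UnitaryGroup.conjLocal_conjLocal c v hcδ hδ) (X 1 0) (X 0 0) (X 0 1) hx hy) hXe,
      ← nSiegel_eq_nSiegelBlk (UnitaryGroup.LocalRing E v) (UnitaryGroup.conjLocal E c v) (UnitaryGroup.conjLocal_conjLocal c v hcδ hδ) (X 1 0) (X 0 0) (X 0 1) hx hy,
      nSiegel, map_mul, map_mul, map_mul, map_mul]
  have hw : ∀ y : v.adicCompletion F,
      FrameTransport.frameConj F E c v (2 + 2) hJ₂D (antidiagonal_over_eq_map F E 2) Q hQ (toLocalFour F E c v (weylTwo (UnitaryGroup.LocalRing E v) (UnitaryGroup.conjLocal E c v))) *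
        FrameTransport.frameConj F E c v (2 + 2) hJ₂D (antidiagonal_over_eq_map F E 2) Q hQ (toLocalFour F E c v (uLongTwo (UnitaryGroup.LocalRing E v) (UnitaryGroup.conjLocal E c v)
          (UnitaryGroup.toLocalRing E v y * algebraMap E (UnitaryGroup.LocalRing E v) δ) (conjLocal_coord F E c hcδ v y))) *
        (FrameTransport.frameConj F E c v (2 + 2) hJ₂D (antidiagonal_over_eq_map F E 2) Q hQ
          (toLocalFour F E c v (nSiegelBlk (UnitaryGroup.LocalRing E v) (UnitaryGroup.conjLocal E c v) hX)) * g) =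
      FrameTransport.frameConj F E c v (2 + 2) hJ₂D (antidiagonal_over_eq_map F E 2) Q hQ (toLocalFour F E c v (weylTwo (UnitaryGroup.LocalRing E v) (UnitaryGroup.conjLocal E c v))) *
        FrameTransport.frameConj F E c v (2 + 2) hJ₂D (antidiagonal_over_eq_map F E 2) Q hQ (toLocalFour F E c v (uLongTwo (UnitaryGroup.LocalRing E v) (UnitaryGroup.conjLocal E c v)
          (UnitaryGroup.toLocalRing E v y * algebraMap E (UnitaryGroup.LocalRing E v) δ) (conjLocal_coord F E c hcδ v y))) *
        (FrameTransport.frameConj F E c v (2 + 2) hJ₂D (antidiagonal_over_eq_map F E 2) Q hQ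
            (toLocalFour F E c v (uLongTwo (UnitaryGroup.LocalRing E v) (UnitaryGroup.conjLocal E c v) (X 1 0) hx)) *
          (FrameTransport.frameConj F E c v (2 + 2) hJ₂D (antidiagonal_over_eq_map F E 2) Q hQ
              (toLocalFour F E c v (uPlus (UnitaryGroup.LocalRing E v) (UnitaryGroup.conjLocal E c v) (UnitaryGroup.conjLocal_conjLocal c v hcδ hδ) (X 0 0))) *
            (FrameTransport.frameConj F E c v (2 + 2) hJ₂D (antidiagonal_over_eq_map F E 2) Q hQ
                (toLocalFour F E c v (uLongOne (UnitaryGroup.LocalRing E v) (UnitaryGroup.conjLocal E c v) (X 0 1) hy)) * g))) := by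
    intro y; rw [hn]; simp only [mul_assoc]
  simp_rw [hw]
  rw [stageLong_apply_uLongTwo F E c hcδ hδ v hJ₂D Q hQ μF F', stageLong_apply_uPlus F E c hcδ hδ v hJ₂D Q hQ μF F' hM,
    stageLong_apply_uLongOne F E c hcδ v hJ₂D Q hQ μF F' hL]

end Invariance

/-! ## §2 The torus law of `𝒜F` -/

section Torus

variable [MeasurableSpace (v.adicCompletion F)] [BorelSpace (v.adicCompletion F)] (μF : Measure (v.adicCompletion F)) [μF.IsAddHaarMeasure]
  (F' : UnitaryGroup.localPi E c (2 + 2) J₂D v → ℂ)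

include hcδ hδ in
/-- **THE TORUS LAW OF `𝒜F`**: `𝒜F(φ(t(a,b)) g) = θ a (σb)⁻¹ · (∏_w ‖b_w‖) · 𝒜F(g)` for a `θ`-eigenfunction `F` of the transported torus.
The torus word (★ B4d-1) rescales the root coordinate by the `σ`-fixed unit `(bσb)⁻¹ = ι_v(γ)⁻¹`, `|γ|_v = ∏_w ‖b_w‖` (§0), and `∫ G(γ⁻¹ y) dμ_F(y) = |γ|_v ∫ G dμ_F`
(★ `integral_comp_mul_left`). [cite: Casselman1980, §3] [cite: Tate1950, §2.2] -/
theorem stageLong_apply_torusElt (θ : (UnitaryGroup.LocalRing E v)ˣ → (UnitaryGroup.LocalRing E v)ˣ → ℂ)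
    (hT : ∀ (a b : (UnitaryGroup.LocalRing E v)ˣ) (g : UnitaryGroup.localPi E c (2 + 2) J₂D v),
      F' (FrameTransport.frameConj F E c v (2 + 2) hJ₂D (antidiagonal_over_eq_map F E 2) Q hQ
        (toLocalFour F E c v (torusElt (UnitaryGroup.LocalRing E v) (UnitaryGroup.conjLocal E c v)
          (UnitaryGroup.conjLocal_conjLocal c v hcδ hδ) a b)) * g) = θ a b * F' g)
    (a b : (UnitaryGroup.LocalRing E v)ˣ) (g : UnitaryGroup.localPi E c (2 + 2) J₂D v) :
    ∫ y, F' (FrameTransport.frameConj F E c v (2 + 2) hJ₂D (antidiagonal_over_eq_map F E 2) Q hQ (toLocalFour F E c v (weylTwo (UnitaryGroup.LocalRing E v) (UnitaryGroup.conjLocal E c v))) *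
        FrameTransport.frameConj F E c v (2 + 2) hJ₂D (antidiagonal_over_eq_map F E 2) Q hQ (toLocalFour F E c v (uLongTwo (UnitaryGroup.LocalRing E v) (UnitaryGroup.conjLocal E c v)
          (UnitaryGroup.toLocalRing E v y * algebraMap E (UnitaryGroup.LocalRing E v) δ) (conjLocal_coord F E c hcδ v y))) *
        (FrameTransport.frameConj F E c v (2 + 2) hJ₂D (antidiagonal_over_eq_map F E 2) Q hQ
          (toLocalFour F E c v (torusElt (UnitaryGroup.LocalRing E v) (UnitaryGroup.conjLocal E c v) (UnitaryGroup.conjLocal_conjLocal c v hcδ hδ) a b)) * g)) ∂μF =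
      θ a (Units.map (UnitaryGroup.conjLocal E c v : UnitaryGroup.LocalRing E v →* UnitaryGroup.LocalRing E v) b⁻¹) *
        ((∏ w : PlacesOver E v, ‖(b : UnitaryGroup.LocalRing E v) w‖ : ℝ) : ℂ) *
      ∫ y, F' (FrameTransport.frameConj F E c v (2 + 2) hJ₂D (antidiagonal_over_eq_map F E 2) Q hQ (toLocalFour F E c v (weylTwo (UnitaryGroup.LocalRing E v) (UnitaryGroup.conjLocal E c v))) *
        FrameTransport.frameConj F E c v (2 + 2) hJ₂D (antidiagonal_over_eq_map F E 2) Q hQ (toLocalFour F E c v (uLongTwo (UnitaryGroup.LocalRing E v) (UnitaryGroup.conjLocal E c v)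
          (UnitaryGroup.toLocalRing E v y * algebraMap E (UnitaryGroup.LocalRing E v) δ) (conjLocal_coord F E c hcδ v y))) * g) ∂μF := by
  -- the `σ`-fixed unit `b σ(b) = ι_v(γ)`
  set bb : (UnitaryGroup.LocalRing E v)ˣ := b * Units.map (UnitaryGroup.conjLocal E c v : UnitaryGroup.LocalRing E v →* UnitaryGroup.LocalRing E v) b with hbb
  have hfix : UnitaryGroup.conjLocal E c v (bb : UnitaryGroup.LocalRing E v) = bb := by
    rw [hbb, Units.val_mul, Units.coe_map, map_mul, MonoidHom.coe_coe, UnitaryGroup.conjLocal_conjLocal c v hcδ hδ, mul_comm]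
  obtain ⟨γ, hγ⟩ := exists_toLocalRing_eq_of_conjLocal_eq F E c hcδ hδ v hfix
  have hγ0 : γ ≠ 0 := by
    rintro rfl
    rw [map_zero] at hγ
    exact bb.ne_zero hγ.symm
  have hγinv : UnitaryGroup.toLocalRing E v γ⁻¹ = ((bb⁻¹ : (UnitaryGroup.LocalRing E v)ˣ) : UnitaryGroup.LocalRing E v) := by
    refine (Units.inv_eq_of_mul_eq_one_left ?_).symm
    rw [← hγ, ← map_mul, inv_mul_cancel₀ hγ0, map_one]
  -- integrand-wise: the torus word, with the rescaled coordinate `γ⁻¹ y`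
  have h : ∀ y : v.adicCompletion F,
      F' (FrameTransport.frameConj F E c v (2 + 2) hJ₂D (antidiagonal_over_eq_map F E 2) Q hQ (toLocalFour F E c v (weylTwo (UnitaryGroup.LocalRing E v) (UnitaryGroup.conjLocal E c v))) *
        FrameTransport.frameConj F E c v (2 + 2) hJ₂D (antidiagonal_over_eq_map F E 2) Q hQ (toLocalFour F E c v (uLongTwo (UnitaryGroup.LocalRing E v) (UnitaryGroup.conjLocal E c v)
          (UnitaryGroup.toLocalRing E v y * algebraMap E (UnitaryGroup.LocalRing E v) δ) (conjLocal_coord F E c hcδ v y))) *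
        (FrameTransport.frameConj F E c v (2 + 2) hJ₂D (antidiagonal_over_eq_map F E 2) Q hQ
          (toLocalFour F E c v (torusElt (UnitaryGroup.LocalRing E v) (UnitaryGroup.conjLocal E c v) (UnitaryGroup.conjLocal_conjLocal c v hcδ hδ) a b)) * g)) =
      θ a (Units.map (UnitaryGroup.conjLocal E c v : UnitaryGroup.LocalRing E v →* UnitaryGroup.LocalRing E v) b⁻¹) *
        F' (FrameTransport.frameConj F E c v (2 + 2) hJ₂D (antidiagonal_over_eq_map F E 2) Q hQ (toLocalFour F E c v (weylTwo (UnitaryGroup.LocalRing E v) (UnitaryGroup.conjLocal E c v))) *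
          FrameTransport.frameConj F E c v (2 + 2) hJ₂D (antidiagonal_over_eq_map F E 2) Q hQ (toLocalFour F E c v (uLongTwo (UnitaryGroup.LocalRing E v) (UnitaryGroup.conjLocal E c v)
            (UnitaryGroup.toLocalRing E v (γ⁻¹ * y) * algebraMap E (UnitaryGroup.LocalRing E v) δ) (conjLocal_coord F E c hcδ v (γ⁻¹ * y)))) * g) := by
    intro y
    rw [apply_weylTwo_uLongTwo_mul_torusElt F E c hcδ hδ v hJ₂D Q hQ F' θ hT,
      uLongTwo_congr F E c v _ (conjLocal_coord F E c hcδ v (γ⁻¹ * y)) (by rw [← hbb, ← hγinv, map_mul, mul_assoc])]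
  simp_rw [h]
  rw [integral_const_mul]
  have hsub := Literature.NumberTheory.Automorphic.integral_comp_mul_left μF (inv_ne_zero hγ0) fun y => F' (FrameTransport.frameConj F E c v (2 + 2) hJ₂D (antidiagonal_over_eq_map F E 2) Q hQ (toLocalFour F E c v (weylTwo (UnitaryGroup.LocalRing E v) (UnitaryGroup.conjLocal E c v))) *
          FrameTransport.frameConj F E c v (2 + 2) hJ₂D (antidiagonal_over_eq_map F E 2) Q hQ (toLocalFour F E c v (uLongTwo (UnitaryGroup.LocalRing E v) (UnitaryGroup.conjLocal E c v)
            (UnitaryGroup.toLocalRing E v y * algebraMap E (UnitaryGroup.LocalRing E v) δ) (conjLocal_coord F E c hcδ v y))) * g)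
  rw [inv_inv, Complex.real_smul, ← norm_eq_coe_normAbs F v, norm_eq_prod_norm_of_toLocalRing_eq F E c v γ b (hγ.trans (by rw [hbb]))] at hsub
  rw [hsub, mul_assoc]

end Torus


end Summit.HodgeConjecture.HodgeConjecture.Cruxes.HLiu418.K2LiuSiegelCocycleStageLong

end
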